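import Literature.NumberTheory.QuadraticForms.TransferFormDiagonal
import Literature.NumberTheory.QuadraticForms.MeyerRat
import HarnessLib

/-!
# Rational diagonal forms as sums of binary blocks `t⟨1, d n⟩`, `n` a norm from `ℚ(√d)`

Topic `Literature/NumberTheory/QuadraticForms`; namespace `Literature.NumberTheory.QuadraticForms`.
Everything here is proved. This is the arithmetic (`ℚ`-side) half of the discharge of Cor. 11.4
of Bayer-Fluckiger–van Geemen–Schütt 2025 (`BFvGS2025_transfer_realQuadratic_of_det_neg_one`,
`TransferForm.lean`; assembled in `TransferFormProofs.lean`). The only local–global input is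
**Meyer's theorem** in rank `5` (`exists_quinary_zero_rat_of_indefinite`, `MeyerRat.lean`,
proved in the tree from Hasse–Minkowski), used three ways (`d > 0` a non-square, `N(g + h√d) =
g² - d h²`):

* `exists_ternary_apply_eq_norm_mul` — **the Meyer trick**: a ternary diagonal form
  `⟨c₀, c₁, c₂⟩` (`cᵢ ≠ 0`) represents an element of the coset `t · d · N(ℚ(√d)^×) · ℚ^{×2}`
  for every `t ≠ 0`: the quinary form `⟨c₀, c₁, c₂, -td, td²⟩` is indefinite, hence isotropic;
  a zero `(v, X, Y)` gives `⟨c⟩(v) = t d (X² - d Y²)`, and if `X = Y = 0` the ternary form is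
  isotropic hence universal;
* `exists_apply_eq_of_forall_neg` — a negative definite diagonal form in `≥ 4` variables
  represents every negative rational (`⟨w₀, …, w₃, -τ⟩` is indefinite);
* `exists_negCarve` — by induction, a negative diagonal form in `2c + 3` variables is
  `≅ ⟨-1, -d⟩^{⊥ c} ⊥ ⟨n₀, n₁, n₂⟩` with `∏ w = ρ² d^c ∏ n`;
* `exists_three_blocks` — the **rank-`6` step**: `⟨a₀, a₁, a₂, n₀, n₁, n₂⟩` with `aᵢ > 0 > nᵢ`
  and `∏ a ∏ n = -s²` is `≅ ⟨t₀, x₀⟩ ⊥ ⟨t₁, x₁⟩ ⊥ ⟨t₂, x₂⟩` with `xᵢ = tᵢ d (gᵢ² - d hᵢ²) ρᵢ²`,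
  the first block indefinite and the other two either both indefinite or (positive definite,
  negative definite) — Sylvester's law of inertia decides which.

These are the steps of an elementary proof of Cor. 11.4 replacing the Witt-group transfer
argument of the source ([BGS] = Bayer-Fluckiger–van Geemen–Schütt 2024, Thm. 9.3, Lemma 10.3) by
Meyer's theorem; the transfer blocks `T⟨β⟩ ≅ t⟨1, d N(β')⟩` are identified in
`TransferFormRealQuadratic.lean`.

## References

* [BayerFluckigerVanGeemenSchuett2025] E. Bayer-Fluckiger, B. van Geemen, M. Schütt,
  *Non-projective K3 surfaces with real or Salem multiplication*, arXiv:2511.19970, Thm. 11.2,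
  Cor. 11.3, Cor. 11.4.
* J.-P. Serre, *A Course in Arithmetic*, GTM 7, Springer 1973, Ch. IV §3.2 Cor. 2 (Meyer) and
  Ch. IV §1 (PDF pp. 27–31, 39–41). [Serre1973]
-/

namespace Literature.NumberTheory.QuadraticForms

open QuadraticMap Module

/-! ### Norms `g² - d h²` -/

/-- Every norm `g² - d h² ≠ 0` from `ℚ(√d)` (`d ≠ 0, 1`) is a norm `g'² - d h'²` with `g' ≠ 0`:
if `g = 0`, `-d h² = (2dh/(d-1))² - d (h(d+1)/(d-1))²`. [folklore] -/
theorem exists_norm_eq_fst_ne_zero {d : ℚ} (hd0 : d ≠ 0) (hd1 : d ≠ 1) {g h : ℚ}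
    (hn : g ^ 2 - d * h ^ 2 ≠ 0) :
    ∃ g' h' : ℚ, g' ≠ 0 ∧ g' ^ 2 - d * h' ^ 2 = g ^ 2 - d * h ^ 2 := by
  by_cases hg : g = 0
  · subst hg
    have hh : h ≠ 0 := by rintro rfl; exact hn (by ring)
    have hd1' : d - 1 ≠ 0 := sub_ne_zero.mpr hd1
    refine ⟨2 * d * h / (d - 1), h * (d + 1) / (d - 1), ?_, ?_⟩
    · exact div_ne_zero (mul_ne_zero (mul_ne_zero two_ne_zero hd0) hh) hd1'
    · field_simp
      ring
  · exact ⟨g, h, hg, rfl⟩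

/-! ### The Meyer trick -/

/-- **The Meyer trick.** Let `d > 0` be a non-square and `c₀, c₁, c₂, t ∈ ℚ^×`. Then the ternary
form `⟨c₀, c₁, c₂⟩` represents an element `t d (g² - d h²) ρ²` (`g, ρ ≠ 0`, `g² - dh² ≠ 0`) of
the coset `t d N(ℚ(√d)^×) ℚ^{×2}`: by Meyer's theorem (Serre, Ch. IV §3.2 Cor. 2) the indefinite
quinary form `⟨c₀, c₁, c₂, -td, td²⟩` has a non-trivial zero `(v, X, Y)`; then
`⟨c⟩(v) = td(X² - dY²)`, and if `X² - dY² = 0` then `X = Y = 0`, `v ≠ 0` is an isotropic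
vector of `⟨c⟩`, which is then universal. [cite: Serre1973, Ch. IV §3.2 Cor. 2] -/
theorem exists_ternary_apply_eq_norm_mul {d : ℚ} (hd : 0 < d) (hd1 : ¬ IsSquare d)
    {c : Fin 3 → ℚ} (hc : ∀ i, c i ≠ 0) {t : ℚ} (ht : t ≠ 0) :
    ∃ (v : Fin 3 → ℚ) (g h ρ : ℚ), g ≠ 0 ∧ ρ ≠ 0 ∧ g ^ 2 - d * h ^ 2 ≠ 0 ∧
      weightedSumSquares ℚ c v = t * d * (g ^ 2 - d * h ^ 2) * ρ ^ 2 := by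
  have hd0 : d ≠ 0 := hd.ne'
  have hd1' : d ≠ 1 := fun h => hd1 ⟨1, by rw [h, mul_one]⟩
  have h3 : -(t * d) ≠ 0 := neg_ne_zero.mpr (mul_ne_zero ht hd0)
  have h4 : t * d ^ 2 ≠ 0 := mul_ne_zero ht (pow_ne_zero 2 hd0)
  have hpos : ¬ (0 < c 0 ∧ 0 < c 1 ∧ 0 < c 2 ∧ 0 < -(t * d) ∧ 0 < t * d ^ 2) := by
    rintro ⟨-, -, -, h1, h2⟩
    nlinarith
  have hneg : ¬ (c 0 < 0 ∧ c 1 < 0 ∧ c 2 < 0 ∧ -(t * d) < 0 ∧ t * d ^ 2 < 0) := by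
    rintro ⟨-, -, -, h1, h2⟩
    nlinarith
  obtain ⟨x, hx0, hx⟩ := exists_quinary_zero_rat_of_indefinite (hc 0) (hc 1) (hc 2) h3 h4 hpos hneg
  have hval : ∀ w : Fin 3 → ℚ, weightedSumSquares ℚ c w =
      c 0 * w 0 ^ 2 + c 1 * w 1 ^ 2 + c 2 * w 2 ^ 2 := fun w => by
    rw [weightedSumSquares_apply, Fin.sum_univ_three]
    simp only [smul_eq_mul]
    ring
  have hcv : c 0 * x 0 ^ 2 + c 1 * x 1 ^ 2 + c 2 * x 2 ^ 2 = t * d * (x 3 ^ 2 - d * x 4 ^ 2) := by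
    linear_combination hx
  by_cases hn : x 3 ^ 2 - d * x 4 ^ 2 = 0
  · -- `X = Y = 0`: the ternary form is isotropic, hence universal
    have hx4 : x 4 = 0 := by
      by_contra h4'
      exact hd1 ⟨x 3 / x 4, by field_simp; linear_combination -hn⟩
    have hx3 : x 3 = 0 := by
      rw [hx4] at hn
      simpa using hn
    have hiso : c 0 * x 0 ^ 2 + c 1 * x 1 ^ 2 + c 2 * x 2 ^ 2 = 0 := by
      rw [hcv, hn, mul_zero]
    -- some coordinate of `(x 0, x 1, x 2)` is non-zero
    have hsome : x 0 ≠ 0 ∨ x 1 ≠ 0 ∨ x 2 ≠ 0 := by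
      by_contra hall
      push Not at hall
      obtain ⟨h0, h1, h2⟩ := hall
      apply hx0
      ext i
      fin_cases i <;> simp [h0, h1, h2, hx3, hx4]
    -- `v = (t d cᵢ - 1) x' + 2 xᵢ eᵢ` has `⟨c⟩(v) = t d (2 cᵢ xᵢ)²`
    rcases hsome with h0 | h1 | h2
    · refine ⟨![(t * d * c 0 - 1) * x 0 + 2 * x 0, (t * d * c 0 - 1) * x 1,
        (t * d * c 0 - 1) * x 2], 1, 0, 2 * c 0 * x 0, one_ne_zero,
        mul_ne_zero (mul_ne_zero two_ne_zero (hc 0)) h0, by norm_num, ?_⟩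
      rw [hval]
      simp only [Matrix.cons_val_zero, Matrix.cons_val_one, Matrix.cons_val]
      linear_combination ((t * d * c 0 - 1) ^ 2) * hiso
    · refine ⟨![(t * d * c 1 - 1) * x 0, (t * d * c 1 - 1) * x 1 + 2 * x 1,
        (t * d * c 1 - 1) * x 2], 1, 0, 2 * c 1 * x 1, one_ne_zero,
        mul_ne_zero (mul_ne_zero two_ne_zero (hc 1)) h1, by norm_num, ?_⟩
      rw [hval]
      simp only [Matrix.cons_val_zero, Matrix.cons_val_one, Matrix.cons_val]
      linear_combination ((t * d * c 1 - 1) ^ 2) * hiso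
    · refine ⟨![(t * d * c 2 - 1) * x 0, (t * d * c 2 - 1) * x 1,
        (t * d * c 2 - 1) * x 2 + 2 * x 2], 1, 0, 2 * c 2 * x 2, one_ne_zero,
        mul_ne_zero (mul_ne_zero two_ne_zero (hc 2)) h2, by norm_num, ?_⟩
      rw [hval]
      simp only [Matrix.cons_val_zero, Matrix.cons_val_one, Matrix.cons_val]
      linear_combination ((t * d * c 2 - 1) ^ 2) * hiso
  · -- `⟨c⟩(x 0, x 1, x 2) = t d (X² - d Y²)` with `X² - dY² ≠ 0`; make the first entry non-zero
    obtain ⟨g', h', hg', hgh⟩ := exists_norm_eq_fst_ne_zero hd0 hd1' hn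
    refine ⟨![x 0, x 1, x 2], g', h', 1, hg', one_ne_zero, by rwa [hgh], ?_⟩
    rw [hval, hgh]
    simp only [Matrix.cons_val_zero, Matrix.cons_val_one, Matrix.cons_val]
    linear_combination hcv

/-- **A negative definite diagonal form in `≥ 4` variables represents every negative
rational**: for `wᵢ < 0` and `τ < 0` the quinary form `⟨w₀, w₁, w₂, w₃, -τ⟩` is indefinite,
hence has a non-trivial zero by Meyer's theorem, whose last coordinate is non-zero by
definiteness. [cite: Serre1973, Ch. IV §3.2 Cor. 2] -/
theorem exists_apply_eq_of_forall_neg {k : ℕ} (w : Fin (k + 4) → ℚ) (hw : ∀ i, w i < 0) {τ : ℚ}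
    (hτ : τ < 0) : ∃ v : Fin (k + 4) → ℚ, weightedSumSquares ℚ w v = τ := by
  have hpos : ¬ (0 < w 0 ∧ 0 < w (Fin.succ 0) ∧ 0 < w (Fin.succ (Fin.succ 0)) ∧
      0 < w (Fin.succ (Fin.succ (Fin.succ 0))) ∧ 0 < -τ) := fun h => not_lt_of_gt (hw 0) h.1
  have hneg : ¬ (w 0 < 0 ∧ w (Fin.succ 0) < 0 ∧ w (Fin.succ (Fin.succ 0)) < 0 ∧
      w (Fin.succ (Fin.succ (Fin.succ 0))) < 0 ∧ -τ < 0) := fun h => by linarith [h.2.2.2.2]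
  obtain ⟨x, hx0, hx⟩ := exists_quinary_zero_rat_of_indefinite (hw 0).ne (hw _).ne (hw _).ne
    (hw _).ne (neg_pos.mpr hτ).ne' hpos hneg
  have hle : ∀ (i : Fin (k + 4)) (y : ℚ), w i * y ^ 2 ≤ 0 := fun i y =>
    mul_nonpos_of_nonpos_of_nonneg (hw i).le (sq_nonneg _)
  have hx4 : x 4 ≠ 0 := by
    intro h4
    rw [h4] at hx
    have e0 : w 0 * x 0 ^ 2 = 0 := by
      linarith [hle 0 (x 0), hle (Fin.succ 0) (x 1), hle (Fin.succ (Fin.succ 0)) (x 2),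
        hle (Fin.succ (Fin.succ (Fin.succ 0))) (x 3)]
    have e1 : w (Fin.succ 0) * x 1 ^ 2 = 0 := by
      linarith [hle 0 (x 0), hle (Fin.succ 0) (x 1), hle (Fin.succ (Fin.succ 0)) (x 2),
        hle (Fin.succ (Fin.succ (Fin.succ 0))) (x 3)]
    have e2 : w (Fin.succ (Fin.succ 0)) * x 2 ^ 2 = 0 := by
      linarith [hle 0 (x 0), hle (Fin.succ 0) (x 1), hle (Fin.succ (Fin.succ 0)) (x 2),
        hle (Fin.succ (Fin.succ (Fin.succ 0))) (x 3)]
    have e3 : w (Fin.succ (Fin.succ (Fin.succ 0))) * x 3 ^ 2 = 0 := by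
      linarith [hle 0 (x 0), hle (Fin.succ 0) (x 1), hle (Fin.succ (Fin.succ 0)) (x 2),
        hle (Fin.succ (Fin.succ (Fin.succ 0))) (x 3)]
    have h0 : x 0 = 0 := by simpa [(hw _).ne] using e0
    have h1 : x 1 = 0 := by simpa [(hw _).ne] using e1
    have h2 : x 2 = 0 := by simpa [(hw _).ne] using e2
    have h3 : x 3 = 0 := by simpa [(hw _).ne] using e3
    apply hx0
    ext i
    fin_cases i <;> simp [h0, h1, h2, h3, h4]
  refine ⟨Fin.cons (x 0 / x 4) (Fin.cons (x 1 / x 4) (Fin.cons (x 2 / x 4)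
    (Fin.cons (x 3 / x 4) (0 : Fin k → ℚ)))), ?_⟩
  rw [weightedSumSquares_apply, Fin.sum_univ_succ, Fin.sum_univ_succ, Fin.sum_univ_succ,
    Fin.sum_univ_succ]
  simp only [Fin.cons_zero, Fin.cons_succ, Pi.zero_apply, mul_zero,
    Finset.sum_const_zero, add_zero, smul_eq_mul]
  field_simp
  linear_combination hx

/-! ### Carving negative definite blocks `⟨-1, -d⟩` -/

/-- The orthogonal sum with a form on the zero module `M^∅` changes nothing. [folklore] -/
theorem equivalent_pi_empty_prod {R : Type*} [CommSemiring R] {M M' N : Type*} [AddCommMonoid M]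
    [AddCommMonoid M'] [AddCommMonoid N] [Module R M] [Module R M'] [Module R N]
    (Q₀ : Fin 0 → QuadraticMap R M' N) (Q : QuadraticMap R M N) :
    Equivalent Q ((QuadraticMap.pi Q₀).prod Q) :=
  ⟨{ (LinearEquiv.uniqueProd (R := R) (M := M) (M₂ := Fin 0 → M')).symm with
      map_app' := fun x => by simp [LinearEquiv.uniqueProd] }⟩

/-- **Carving `⟨-1, -d⟩` blocks off a negative definite form** (`d > 0`). A negative diagonal
form `⟨w⟩` in `2c + 3` variables is equivalent to `⟨-1, -d⟩^{⊥ c} ⊥ ⟨n₀, n₁, n₂⟩` with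
`nᵢ < 0`, and `∏ wᵢ = ρ² d^c n₀ n₁ n₂`: represent `-1` (`exists_apply_eq_of_forall_neg`), split it
off, represent `-d` by the complement, split it off, and recurse; the discriminants agree
modulo squares. [cite: Serre1973, Ch. IV §1.4] -/
theorem exists_negCarve {d : ℚ} (hd : 0 < d) (c : ℕ) :
    ∀ (w : Fin (2 * c + 3) → ℚ), (∀ i, w i < 0) →
      ∃ (n : Fin 3 → ℚ) (ρ : ℚ), (∀ i, n i < 0) ∧ ρ ≠ 0 ∧
        (∏ i, w i) = ρ ^ 2 * d ^ c * ∏ i, n i ∧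
        Equivalent (weightedSumSquares ℚ w)
          ((QuadraticMap.pi fun _ : Fin c => weightedSumSquares ℚ ![(-1 : ℚ), -d]).prod
            (weightedSumSquares ℚ n)) := by
  classical
  induction c with
  | zero =>
    intro w hw
    exact ⟨w, 1, hw, one_ne_zero, by simp, equivalent_pi_empty_prod _ _⟩
  | succ c ih =>
    intro w hw
    -- represent `-1` and split it off
    obtain ⟨v₁, hv₁⟩ := exists_apply_eq_of_forall_neg (k := 2 * c + 1) w hw (τ := -1) (by norm_num)
    obtain ⟨w', he₁⟩ := equivalent_weightedSumSquares_cons_of_apply_eq w hv₁ (by norm_num)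
    have hw' : ∀ i, w' i < 0 := fun i => by
      have := forall_neg_of_equivalent_weightedSumSquares hw he₁ i.succ
      rwa [Fin.cons_succ] at this
    -- represent `-d` by the complement and split it off
    obtain ⟨v₂, hv₂⟩ := exists_apply_eq_of_forall_neg (k := 2 * c) w' hw' (τ := -d)
      (neg_neg_of_pos hd)
    obtain ⟨w'', he₂⟩ := equivalent_weightedSumSquares_cons_of_apply_eq w' hv₂ (neg_ne_zero.mpr hd.ne')
    have hw'' : ∀ i, w'' i < 0 := fun i => by
      have := forall_neg_of_equivalent_weightedSumSquares hw' he₂ i.succ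
      rwa [Fin.cons_succ] at this
    -- recurse
    obtain ⟨n, ρ, hn, hρ, hprod, he₃⟩ := ih w'' hw''
    -- discriminants
    obtain ⟨r₁, hr₁, hp₁⟩ := exists_prod_eq_sq_mul_prod he₁
    obtain ⟨r₂, hr₂, hp₂⟩ := exists_prod_eq_sq_mul_prod he₂
    rw [Fin.prod_cons] at hp₁ hp₂
    have hprod' : ∏ i : Fin (2 * (c + 1) + 1), w'' i = ρ ^ 2 * d ^ c * ∏ i, n i := hprod
    refine ⟨n, r₁ * r₂ * ρ, hn, mul_ne_zero (mul_ne_zero hr₁ hr₂) hρ, ?_, ?_⟩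
    · rw [hp₁, hp₂, hprod']
      ring
    · -- regroup `⟨-1, ⟨-d, w''⟩⟩` as `⟨-1, -d⟩ ⊥ (blocks ⊥ ⟨n⟩)`
      refine he₁.trans ((equivalent_weightedSumSquares_cons (-1) w').trans ?_)
      refine (QuadraticMap.Equivalent.prod (QuadraticMap.Equivalent.refl _)
        (he₂.trans ((equivalent_weightedSumSquares_cons (-d) w'').trans
          (QuadraticMap.Equivalent.prod (QuadraticMap.Equivalent.refl _) he₃)))).trans ?_
      refine (equivalent_prod_assoc _ _ _).symm.trans ?_
      refine (QuadraticMap.Equivalent.prod (equivalent_weightedSumSquares_cons (-1) ![-d]).symm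
        (QuadraticMap.Equivalent.refl _)).trans ?_
      refine (equivalent_prod_assoc _ _ _).symm.trans ?_
      exact QuadraticMap.Equivalent.prod
        (equivalent_prod_pi_cons fun _ : Fin (c + 1) => weightedSumSquares ℚ ![(-1 : ℚ), -d])
        (QuadraticMap.Equivalent.refl _)

/-! ### The rank-`6` step -/

/-- Regrouping for the rank-`6` step: `(⟨a₀⟩ ⊥ A) ⊥ (⟨x⟩ ⊥ B) ≅ ⟨a₀, x⟩ ⊥ (A ⊥ B)`. [folklore] -/
theorem equivalent_regroup_pair {M₁ M₂ : Type*} [AddCommGroup M₁] [Module ℚ M₁] [AddCommGroup M₂]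
    [Module ℚ M₂] (a₀ x : ℚ) (A : QuadraticForm ℚ M₁) (B : QuadraticForm ℚ M₂) :
    Equivalent (((weightedSumSquares ℚ ![a₀]).prod A).prod ((weightedSumSquares ℚ ![x]).prod B))
      ((weightedSumSquares ℚ ![a₀, x]).prod (A.prod B)) :=
  ⟨(QuadraticMap.IsometryEquiv.prodProdProdComm _ _ _ _).trans
    (Classical.choice (QuadraticMap.Equivalent.prod
      (equivalent_weightedSumSquares_cons a₀ ![x]).symm (QuadraticMap.Equivalent.refl _)))⟩

/-- **The rank-`6` step.** Let `d > 0` be a non-square, `a₀, a₁, a₂ > 0 > n₀, n₁, n₂` rationals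
with `∏ aᵢ ∏ nᵢ = -s²`. Then `⟨a⟩ ⊥ ⟨n⟩ ≅ ⟨t₀, x₀⟩ ⊥ ⟨t₁, x₁⟩ ⊥ ⟨t₂, x₂⟩` where each
`xᵢ = tᵢ d (gᵢ² - d hᵢ²) ρᵢ²` lies in `tᵢ d N(ℚ(√d)^×) ℚ^{×2}` (`gᵢ, ρᵢ ≠ 0`), `t₀ x₀ < 0`, and
either `t₁ x₁ < 0` and `t₂ x₂ < 0`, or `t₁, x₁ > 0 > t₂, x₂`. Proof: `t₀ = a₀` and `x₀ < 0` a
value of `⟨n⟩` in `a₀ d N ℚ²` (Meyer trick), split off: `⟨n⟩ ≅ ⟨x₀, p, q⟩`; `t₁ = a₁` and `x₁`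
a value of `⟨a₂, p, q⟩` in `a₁ d N ℚ²`, split off: `⟨a₂, p, q⟩ ≅ ⟨x₁, p', q'⟩`; the last block
`⟨p', q'⟩` lies in the right coset because the discriminant `∏ a ∏ n = -s²` is preserved modulo
squares and `-d`, `1/N`, products of norms are norms; the signs of `p', q'` follow from
Sylvester's law of inertia applied to `⟨a₂, p, q⟩ ≅ ⟨x₁, p', q'⟩`. This replaces, over `ℚ`, the
Witt-group argument of Bayer-Fluckiger–van Geemen–Schütt, Thm. 11.2.
[cite: BayerFluckigerVanGeemenSchuett2025, Thm. 11.2] -/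
theorem exists_three_blocks {d : ℚ} (hd : 0 < d) (hd1 : ¬ IsSquare d) {a n : Fin 3 → ℚ}
    (ha : ∀ i, 0 < a i) (hn : ∀ i, n i < 0) {s : ℚ} (hs : (∏ i, a i) * ∏ i, n i = -s ^ 2) :
    ∃ t x g h ρ : Fin 3 → ℚ,
      (∀ i, t i ≠ 0) ∧ (∀ i, g i ≠ 0) ∧ (∀ i, ρ i ≠ 0) ∧ (∀ i, g i ^ 2 - d * h i ^ 2 ≠ 0) ∧
      (∀ i, x i = t i * d * (g i ^ 2 - d * h i ^ 2) * ρ i ^ 2) ∧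
      t 0 * x 0 < 0 ∧
      ((t 1 * x 1 < 0 ∧ t 2 * x 2 < 0) ∨ (0 < t 1 ∧ 0 < x 1 ∧ t 2 < 0 ∧ x 2 < 0)) ∧
      Equivalent ((weightedSumSquares ℚ a).prod (weightedSumSquares ℚ n))
        ((weightedSumSquares ℚ ![t 0, x 0]).prod
          ((weightedSumSquares ℚ ![t 1, x 1]).prod (weightedSumSquares ℚ ![t 2, x 2]))) := by
  classical
  have hd0 : d ≠ 0 := hd.ne'
  have hd1' : d ≠ 1 := fun h => hd1 ⟨1, by rw [h, mul_one]⟩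
  have hs0 : s ≠ 0 := by
    rintro rfl
    have : (∏ i, a i) * ∏ i, n i ≠ 0 := mul_ne_zero
      (Finset.prod_ne_zero_iff.mpr fun i _ => (ha i).ne')
      (Finset.prod_ne_zero_iff.mpr fun i _ => (hn i).ne)
    exact this (by rw [hs]; ring)
  -- block 0: `x₀ = ⟨n⟩(v) ∈ a₀ d N ℚ²`, negative
  obtain ⟨v, g₀, h₀, ρ₀, hg₀, hρ₀, hN₀, hv⟩ :=
    exists_ternary_apply_eq_norm_mul hd hd1 (fun i => (hn i).ne) (ha 0).ne'
  have hx₀0 : a 0 * d * (g₀ ^ 2 - d * h₀ ^ 2) * ρ₀ ^ 2 ≠ 0 :=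
    mul_ne_zero (mul_ne_zero (mul_ne_zero (ha 0).ne' hd0) hN₀) (pow_ne_zero 2 hρ₀)
  have hx₀neg : a 0 * d * (g₀ ^ 2 - d * h₀ ^ 2) * ρ₀ ^ 2 < 0 := by
    rw [← hv]
    refine weightedSumSquares_neg_of_ne_zero hn fun h0 => hx₀0 ?_
    rw [← hv, h0, map_zero]
  obtain ⟨pq, he₁⟩ := equivalent_weightedSumSquares_cons_of_apply_eq n hv hx₀0
  have hpq : ∀ i, pq i < 0 := fun i => by
    have := forall_neg_of_equivalent_weightedSumSquares hn he₁ i.succ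
    rwa [Fin.cons_succ] at this
  obtain ⟨r₁, hr₁, hp₁⟩ := exists_prod_eq_sq_mul_prod he₁
  rw [Fin.prod_cons, Fin.prod_univ_two] at hp₁
  -- block 1: `x₁ = ⟨a₂, p, q⟩(v') ∈ a₁ d N ℚ²`
  set c' : Fin 3 → ℚ := ![a 2, pq 0, pq 1] with hc'
  have hc'0 : ∀ i, c' i ≠ 0 := fun i => by
    fin_cases i
    · exact (ha 2).ne'
    · exact (hpq 0).ne
    · exact (hpq 1).ne
  obtain ⟨v', g₁, h₁, ρ₁, hg₁, hρ₁, hN₁, hv'⟩ :=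
    exists_ternary_apply_eq_norm_mul hd hd1 hc'0 (ha 1).ne'
  have hx₁0 : a 1 * d * (g₁ ^ 2 - d * h₁ ^ 2) * ρ₁ ^ 2 ≠ 0 :=
    mul_ne_zero (mul_ne_zero (mul_ne_zero (ha 1).ne' hd0) hN₁) (pow_ne_zero 2 hρ₁)
  obtain ⟨pq', he₂⟩ := equivalent_weightedSumSquares_cons_of_apply_eq c' hv' hx₁0
  have hpq'0 : ∀ i, pq' i ≠ 0 := fun i => by
    have := forall_ne_zero_of_equivalent_weightedSumSquares hc'0 he₂ i.succ
    rwa [Fin.cons_succ] at this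
  obtain ⟨r₂, hr₂, hp₂⟩ := exists_prod_eq_sq_mul_prod he₂
  rw [Fin.prod_cons, Fin.prod_univ_two, Fin.prod_univ_three] at hp₂
  change a 2 * pq 0 * pq 1 = _ at hp₂
  -- Sylvester: `⟨a₂, p, q⟩ ≅ ⟨x₁, p', q'⟩` have one positive weight each
  have hcount : 1 = ((if 0 < a 1 * d * (g₁ ^ 2 - d * h₁ ^ 2) * ρ₁ ^ 2 then 1 else 0) +
      if 0 < pq' 0 then 1 else 0) + if 0 < pq' 1 then 1 else 0 := by
    have h := ncard_pos_eq_of_equivalent_weightedSumSquares he₂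
    rw [ncard_pos_fin_three, ncard_pos_fin_three] at h
    have e0 : c' 0 = a 2 := rfl
    have e1 : c' 1 = pq 0 := rfl
    have e2 : c' 2 = pq 1 := rfl
    have f0 : (Fin.cons (a 1 * d * (g₁ ^ 2 - d * h₁ ^ 2) * ρ₁ ^ 2) pq' : Fin 3 → ℚ) 0 =
        a 1 * d * (g₁ ^ 2 - d * h₁ ^ 2) * ρ₁ ^ 2 := rfl
    have f1 : (Fin.cons (a 1 * d * (g₁ ^ 2 - d * h₁ ^ 2) * ρ₁ ^ 2) pq' : Fin 3 → ℚ) 1 = pq' 0 :=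
      rfl
    have f2 : (Fin.cons (a 1 * d * (g₁ ^ 2 - d * h₁ ^ 2) * ρ₁ ^ 2) pq' : Fin 3 → ℚ) 2 = pq' 1 :=
      rfl
    rw [e0, e1, e2, f0, f1, f2, if_pos (ha 2), if_neg (not_lt_of_gt (hpq 0)),
      if_neg (not_lt_of_gt (hpq 1))] at h
    simpa using h
  -- block 2: `⟨p', q'⟩`; its coset from the discriminant.
  -- `N₀ N₁ = G² - d H²` (Brahmagupta) and `-d / (N₀ N₁) = g₂² - d h₂²`
  have hNN : (g₀ ^ 2 - d * h₀ ^ 2) * (g₁ ^ 2 - d * h₁ ^ 2) ≠ 0 := mul_ne_zero hN₀ hN₁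
  have hN₂ : (-(d * (g₀ * h₁ + g₁ * h₀)) / ((g₀ ^ 2 - d * h₀ ^ 2) * (g₁ ^ 2 - d * h₁ ^ 2))) ^ 2 -
      d * ((g₀ * g₁ + d * h₀ * h₁) / ((g₀ ^ 2 - d * h₀ ^ 2) * (g₁ ^ 2 - d * h₁ ^ 2))) ^ 2 =
      -d / ((g₀ ^ 2 - d * h₀ ^ 2) * (g₁ ^ 2 - d * h₁ ^ 2)) := by
    rw [div_pow, div_pow, ← mul_div_assoc, div_sub_div_same,
      div_eq_div_iff (pow_ne_zero 2 hNN) hNN]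
    ring
  have hN₂0 : (-(d * (g₀ * h₁ + g₁ * h₀)) / ((g₀ ^ 2 - d * h₀ ^ 2) * (g₁ ^ 2 - d * h₁ ^ 2))) ^ 2 -
      d * ((g₀ * g₁ + d * h₀ * h₁) / ((g₀ ^ 2 - d * h₀ ^ 2) * (g₁ ^ 2 - d * h₁ ^ 2))) ^ 2 ≠ 0 := by
    rw [hN₂]; exact div_ne_zero (neg_ne_zero.mpr hd0) hNN
  obtain ⟨g₂, h₂, hg₂, hgh₂⟩ := exists_norm_eq_fst_ne_zero hd0 hd1' hN₂0
  rw [hN₂] at hgh₂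
  have hD : a 0 * a 1 * d ^ 2 * ρ₀ * ρ₁ * r₁ * r₂ * pq' 0 ≠ 0 :=
    mul_ne_zero (mul_ne_zero (mul_ne_zero (mul_ne_zero (mul_ne_zero (mul_ne_zero
      (mul_ne_zero (ha 0).ne' (ha 1).ne') (pow_ne_zero 2 hd0)) hρ₀) hρ₁) hr₁) hr₂) (hpq'0 0)
  have hρ₂0 : s / (a 0 * a 1 * d ^ 2 * ρ₀ * ρ₁ * r₁ * r₂ * pq' 0) ≠ 0 := div_ne_zero hs0 hD
  have hmain : pq' 0 * pq' 1 * ((g₀ ^ 2 - d * h₀ ^ 2) * (g₁ ^ 2 - d * h₁ ^ 2)) *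
      (a 0 * a 1 * d * ρ₀ * ρ₁ * r₁ * r₂) ^ 2 = -s ^ 2 := by
    rw [← hs, hp₁, Fin.prod_univ_three]
    linear_combination (-(a 0 * a 1 * r₁ ^ 2 * (a 0 * d * (g₀ ^ 2 - d * h₀ ^ 2) * ρ₀ ^ 2))) * hp₂
  have hkey : pq' 1 = pq' 0 * d * (g₂ ^ 2 - d * h₂ ^ 2) *
      (s / (a 0 * a 1 * d ^ 2 * ρ₀ * ρ₁ * r₁ * r₂ * pq' 0)) ^ 2 := by
    rw [hgh₂, div_pow, ← mul_div_assoc, ← mul_div_assoc, div_mul_eq_mul_div, div_div,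
      eq_div_iff (mul_ne_zero hNN (pow_ne_zero 2 hD))]
    linear_combination (d ^ 2 * pq' 0) * hmain
  -- assemble
  refine ⟨![a 0, a 1, pq' 0],
    ![a 0 * d * (g₀ ^ 2 - d * h₀ ^ 2) * ρ₀ ^ 2, a 1 * d * (g₁ ^ 2 - d * h₁ ^ 2) * ρ₁ ^ 2, pq' 1],
    ![g₀, g₁, g₂], ![h₀, h₁, h₂], ![ρ₀, ρ₁, s / (a 0 * a 1 * d ^ 2 * ρ₀ * ρ₁ * r₁ * r₂ * pq' 0)],
    ?_, ?_, ?_, ?_, ?_, ?_, ?_, ?_⟩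
  · intro i; fin_cases i
    · exact (ha 0).ne'
    · exact (ha 1).ne'
    · exact hpq'0 0
  · intro i; fin_cases i
    · exact hg₀
    · exact hg₁
    · exact hg₂
  · intro i; fin_cases i
    · exact hρ₀
    · exact hρ₁
    · exact hρ₂0
  · intro i; fin_cases i
    · exact hN₀
    · exact hN₁
    · change g₂ ^ 2 - d * h₂ ^ 2 ≠ 0
      rw [hgh₂]; exact div_ne_zero (neg_ne_zero.mpr hd0) hNN
  · intro i; fin_cases i
    · rfl
    · rfl
    · exact hkey
  · exact mul_neg_of_pos_of_neg (ha 0) hx₀neg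
  · change (a 1 * (a 1 * d * (g₁ ^ 2 - d * h₁ ^ 2) * ρ₁ ^ 2) < 0 ∧ pq' 0 * pq' 1 < 0) ∨
      (0 < a 1 ∧ 0 < a 1 * d * (g₁ ^ 2 - d * h₁ ^ 2) * ρ₁ ^ 2 ∧ pq' 0 < 0 ∧ pq' 1 < 0)
    rcases lt_or_gt_of_ne hx₁0 with hx₁neg | hx₁pos
    · left
      refine ⟨mul_neg_of_pos_of_neg (ha 1) hx₁neg, ?_⟩
      rw [if_neg (not_lt_of_gt hx₁neg)] at hcount
      rcases lt_or_gt_of_ne (hpq'0 0) with hp' | hp'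
      · rw [if_neg (not_lt_of_gt hp')] at hcount
        rcases lt_or_gt_of_ne (hpq'0 1) with hq' | hq'
        · rw [if_neg (not_lt_of_gt hq')] at hcount
          norm_num at hcount
        · exact mul_neg_of_neg_of_pos hp' hq'
      · rw [if_pos hp'] at hcount
        rcases lt_or_gt_of_ne (hpq'0 1) with hq' | hq'
        · exact mul_neg_of_pos_of_neg hp' hq'
        · rw [if_pos hq'] at hcount
          norm_num at hcount
    · right
      rw [if_pos hx₁pos] at hcount
      rcases lt_or_gt_of_ne (hpq'0 0) with hp' | hp'
      · rcases lt_or_gt_of_ne (hpq'0 1) with hq' | hq'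
        · exact ⟨ha 1, hx₁pos, hp', hq'⟩
        · rw [if_neg (not_lt_of_gt hp'), if_pos hq'] at hcount
          norm_num at hcount
      · rw [if_pos hp'] at hcount
        rcases lt_or_gt_of_ne (hpq'0 1) with hq' | hq'
        · rw [if_neg (not_lt_of_gt hq')] at hcount
          norm_num at hcount
        · rw [if_pos hq'] at hcount
          norm_num at hcount
  · -- `⟨a⟩ ⊥ ⟨n⟩ ≅ ⟨a₀, x₀⟩ ⊥ (⟨a₁, a₂⟩ ⊥ ⟨p, q⟩) ≅ ⟨a₀, x₀⟩ ⊥ (⟨a₁, x₁⟩ ⊥ ⟨p', q'⟩)`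
    change Equivalent ((weightedSumSquares ℚ a).prod (weightedSumSquares ℚ n))
      ((weightedSumSquares ℚ ![a 0, a 0 * d * (g₀ ^ 2 - d * h₀ ^ 2) * ρ₀ ^ 2]).prod
        ((weightedSumSquares ℚ ![a 1, a 1 * d * (g₁ ^ 2 - d * h₁ ^ 2) * ρ₁ ^ 2]).prod
          (weightedSumSquares ℚ ![pq' 0, pq' 1])))
    have ha3 : a = Fin.cons (a 0) ![a 1, a 2] := by
      ext i; fin_cases i <;> rfl
    have hpq2 : pq = ![pq 0, pq 1] := by ext i; fin_cases i <;> rfl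
    have hpq2' : pq' = ![pq' 0, pq' 1] := by ext i; fin_cases i <;> rfl
    have e1 : Equivalent (weightedSumSquares ℚ a)
        ((weightedSumSquares ℚ ![a 0]).prod (weightedSumSquares ℚ ![a 1, a 2])) := by
      conv_lhs => rw [ha3]
      exact equivalent_weightedSumSquares_cons (a 0) ![a 1, a 2]
    have e2 : Equivalent (weightedSumSquares ℚ n)
        ((weightedSumSquares ℚ ![a 0 * d * (g₀ ^ 2 - d * h₀ ^ 2) * ρ₀ ^ 2]).prod
          (weightedSumSquares ℚ ![pq 0, pq 1])) := by
      refine he₁.trans ?_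
      conv_lhs => rw [hpq2]
      exact equivalent_weightedSumSquares_cons _ ![pq 0, pq 1]
    have e3 : Equivalent
        ((weightedSumSquares ℚ ![a 1, a 2]).prod (weightedSumSquares ℚ ![pq 0, pq 1]))
        ((weightedSumSquares ℚ ![a 1]).prod (weightedSumSquares ℚ c')) := by
      refine (QuadraticMap.Equivalent.prod (equivalent_weightedSumSquares_cons (a 1) ![a 2])
        (QuadraticMap.Equivalent.refl _)).trans ?_
      refine (equivalent_prod_assoc _ _ _).trans ?_
      exact QuadraticMap.Equivalent.prod (QuadraticMap.Equivalent.refl _)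
        (equivalent_weightedSumSquares_cons (a 2) ![pq 0, pq 1]).symm
    have e4 : Equivalent (weightedSumSquares ℚ c')
        ((weightedSumSquares ℚ ![a 1 * d * (g₁ ^ 2 - d * h₁ ^ 2) * ρ₁ ^ 2]).prod
          (weightedSumSquares ℚ ![pq' 0, pq' 1])) := by
      refine he₂.trans ?_
      conv_lhs => rw [hpq2']
      exact equivalent_weightedSumSquares_cons _ ![pq' 0, pq' 1]
    refine (QuadraticMap.Equivalent.prod e1 e2).trans ?_
    refine (equivalent_regroup_pair (a 0) _ _ _).trans ?_
    refine QuadraticMap.Equivalent.prod (QuadraticMap.Equivalent.refl _) ?_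
    refine e3.trans ?_
    refine (QuadraticMap.Equivalent.prod (QuadraticMap.Equivalent.refl _) e4).trans ?_
    refine (equivalent_prod_assoc _ _ _).symm.trans ?_
    exact QuadraticMap.Equivalent.prod (equivalent_weightedSumSquares_cons (a 1) ![_]).symm
      (QuadraticMap.Equivalent.refl _)

end Literature.NumberTheory.QuadraticForms
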